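/-
Copyright (c) 2026 the pub-hodgecm-mathlib formalisation cell (harness21).  Prover seat hodgecm-mathlib-K2E3-p14 (g10) (E3 hand on strike line L1; LEAD F0P6-plan (g16)
BATCH #273 (2) ∕ #276 (2) «F2d», U1 desk K2E3-p28 (g4) one-writer word 2026-09-05T03:09:38Z), Track B «K2-LIT» ∕ hLiu418 = `stmt-HodgeConjecture-24832`: file F2d of
K2E3-p32 (g4)'s payer cut beneath K2E3-p23 (g9)'s U1-glob TOP ★ p864881 `K2LiuResidueVanishesOfPresentation` (#42F′ `slot_vanRes2E`) — THE ARCH DATA OF RECORD: ★ F2c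
p864914 `exists_archPure_presentation` COMPOSED with F2b's per-summand archimedean kernel datum taken BY VALUE.  THEOREMS ONLY (no `def` ∕ `instance` ∕ notation ∕ named-fact
hypothesis ∕ `sorry`); lane `--supports stmt-HodgeConjecture-24832 --as helper` (count-neutral).
-/
import Summits.HodgeConjecture.HodgeConjecture.Theorems.K2LiuTwistedSWFamilyArchPurePresentation   -- ★ F2c p864914 (K2E3-p32 (g4)): `exists_archPure_presentation`
import Summits.HodgeConjecture.HodgeConjecture.Theorems.K2LiuTwistedSWPureTensorArchDatum         -- ★ F2b p865003 (LH4-p09 (g11)): `exists_archDatum_of_pureTensor` (§2, the by-name edition)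
import HarnessLib

/-!
# Crux `HLiu418`, U1-glob TOP (#42F′ `slot_vanRes2E`), payer file F2d `K2LiuTwistedSWFamilyArchDataOfRecord`: THE ARCH-PURE PRESENTATION OF THE TWISTED SIEGEL–WEIL
# FAMILY OF `x ∈ D_V` WITH ★ END'S KERNEL DATUM `(aφ_j, b_j, y₀_j)` ON EVERY SUMMAND — ★ F2c ∘ (F2b by value)

Cell `hodgecm-mathlib`, crux item hLiu418 = `stmt-HodgeConjecture-24832` (helper lane, count-neutral); squad K2 ∕ E3, strike line L1, LEAD F0P6-plan (g16) BATCH #276 (2);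
TOP pen K2E3-p23 (g9) (★ F1 p864881 `K2LiuResidueVanishesOfPresentation.resGen_eq_zero_of_presentation`); F2 integrator K2E3-p32 (g4) (★ F2a p864850 `K2LiuSWSectionArchFinSplit`,
★ F2c p864914 `K2LiuTwistedSWFamilyArchPurePresentation`, F2b head `K2LiuTwistedSWPureTensorArchDatum` a949338d5bea1a75 — body LH4-p09 (g11)); U1 desk K2E3-p28 (g4); typist
K2E3-typ3 (g3).

THE POINT.  ★ F1 takes — hypothesis-first — the PRESENTATION `f_x = Σ_{j : Fin m} cf_j • stdExtension 𝒦 s₀ (φ_j)` of the twisted Siegel–Weil family of `x ∈ D_V` by standard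
continuous families (binders `(cf φ hpres hstd hcont)`) AND, for every summand, ★ END p864406's ARCH-PURE DATUM `(aφ_j, b_j)` with `hφ hb hbfin hbc` and a point `(y₀_j, hy₀_j)`.
★ F2c `exists_archPure_presentation` pays the presentation for `x ∈ D_V` with PURE-TENSOR summands `φ_j = α(det ·)·f^{V′}_{E(a_j ⊗ f_j)}`, `a_j ∈ V`, each with a BASE POINT
`φ_j(h₀ j) ≠ 0` (zero summands dropped); F2b `exists_archDatum_of_pureTensor` pays, for ONE pure tensor with a base point, the datum `(aφ, b)` with `hφ hb hbfin hbc`, `b(h₀,∞) ≠ 0` and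
the FORMULA `b x = φ((1,h₀,f)·(x,1))`.  THIS FILE composes them: F2b's six-clause conclusion is taken BY VALUE as the hypothesis `hdatum` (for every `a ∈ V`, `f`, `h₀` with
`φ h₀ ≠ 0`) — so the file lands before F2b's body is ★ and the tie (or an ED. 2 here) discharges `hdatum := fun a ha f h₀ hφ₀ => exists_archDatum_of_pureTensor … ha f h₀ hφ₀` by
name (§2 `exists_archPure_presentation_archData_of_record` does exactly this over ★ F2b p865003) — and the conclusion is ★ F1's whole `j`-indexed presentation surface in ONE `∃`: `m, cf, av, fv, h₀, aφ, b` with `(∀ j, av j ∈ V)`, `hpres`, `hstd`, `hcont`, `hφ`, `hb`, `hbfin`,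
`hbc`, `hy₀` (at `y₀ := fun j => (h₀ j)_∞`) and the formula for `b j` (K2E3-p32 (g4)'s payer remark (a): F3's `harch j` payer reads `b_j`'s `K_∞`-type off `av j ∈ V`).
Proof: `obtain` ★ F2c, `choose` on `hdatum` at the base points — no analysis, no `Finset` algebra re-run (one writer per derivation).
References: [KudlaRallis1994] §1; [HarrisKudlaSweet1996] §1 (1.15)–(1.17); [BorelJacquet1979] §4.1 (factorizable vectors `g = g_∞ g_f`); [Tan1999] §1 p. 166; [Weil1964] Chap. III n° 38–40.
HONEST LABEL.  Count-neutral helper: `HC_CM` is proved only modulo the 7 printed citations (2 remaining named inputs: hLiu418 = `stmt-HodgeConjecture-24832`,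
h413 = `stmt-HodgeConjecture-24833`) until rung 0 closes; U1-glob stays OPEN — F2b's per-summand datum is BY VALUE here (`hdatum`), F3's dead arch block `harch j` is the (σ-A) road's.
-/

set_option autoImplicit false
set_option linter.dupNamespace false -- the mandated namespace repeats `HodgeConjecture.HodgeConjecture`
-- the doubled metaplectic carriers elaborate slowly (cf. ★ F2c, ★ F1): sequential elaboration
set_option Elab.async false

noncomputable section

open scoped Matrix TensorProduct SchwartzMap BigOperators Classical
open NumberField NumberField.mixedEmbedding IsDedekindDomain
open Literature.NumberTheory.Automorphic Literature.NumberTheory.Automorphic.UnitaryGroup Literature.NumberTheory.GaloisRepresentations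
open Literature.NumberTheory.GelbartRogawski1991 Literature.NumberTheory.GelbartRogawski1991.GRConstruction
open Literature.NumberTheory.GelbartRogawski1991.UnitaryDualPair
open Literature.NumberTheory.Weil1964 Literature.RepresentationTheory.HarrisKudlaSweet1996
open Literature.NumberTheory.K2Lit.SiegelDoubled

namespace Summit.HodgeConjecture.HodgeConjecture.Cruxes.HLiu418.K2LiuTwistedSWFamilyArchDataOfRecord

open K2LiuTwistedSWFamilyArchPurePresentation (exists_archPure_presentation)
open K2LiuTwistedSWPureTensorArchDatum (exists_archDatum_of_pureTensor)

/-! ## §1 The arch data of record — F2b's per-summand datum BY VALUE (`hdatum`) -/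

variable (L : Type) [Field L] [NumberField L] [IsCMField L]
variable {N M n : ℕ} (e : Fin N × Fin M ≃ Fin n)
  (dV : Fin N → L) (hdV : ∀ i, IsCMField.complexConj L (dV i) = dV i) (hdV0 : ∀ i, dV i ≠ 0)
  (dW : Fin M → L) (hdW : ∀ i, IsCMField.complexConj L (dW i) = dW i) (hdW0 : ∀ i, dW i ≠ 0)
variable {M₂ M' n' : ℕ} (eW : Fin M × Fin M₂ ≃ Fin M') (e' : Fin N × Fin M' ≃ Fin n')
  (dV' : Fin M₂ → L) (hdV' : ∀ k, IsCMField.complexConj L (dV' k) = dV' k) (hdV'0 : ∀ k, dV' k ≠ 0)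

/-- **THE ARCH DATA OF RECORD OF THE TWISTED SIEGEL–WEIL FAMILY OF `x ∈ D_V`.**  K2Lit tensor datum (`s^B` a `χ_b`-normalised doubled Weil representation of the big datum,
`M₂ ≠ 0`), a STANDARD small Iwasawa datum `𝒦`, a finite-dimensional `V` stable slot-wise under the purely archimedean elements of `𝒦.K` (the slot's `hKV`), a continuous automorphic
`α` with `χ_b^{M₂}·α̃ = χ`, `x ∈ D_V = span{E(a ⊗ f) : a ∈ V}`, and — BY VALUE — F2b `exists_archDatum_of_pureTensor`'s datum `hdatum` for every pure-tensor generator with a base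
point.  THEN there are `m`, scalars `cf j`, generators `(av j ∈ V, fv j)`, base points `h₀ j` and data `(aφ j, b j)` with, writing `φ_j := α(det ·)·f^{V′}_{E(av j ⊗ fv j)}` and
`s₀ := (M₂ − n)/2`: (hpres) `α(det ·)·stdExtension 𝒦 s₀ (f^{V′}_x) = Σ_j cf j • stdExtension 𝒦 s₀ φ_j`; (hstd) every `stdExtension 𝒦 s₀ φ_j` is a standard family for `(𝒦, χ)`;
(hcont) continuous in `h`; (hφ) `φ_j(h) = aφ_j(h_f)·b_j(h_∞)`; (hb) the archimedean Siegel law of `I(s₀, χ)`; (hbfin) `K_∞`-finiteness w.r.t. `𝒦.K`; (hbc) continuity; (hy₀)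
`b_j((h₀ j)_∞) ≠ 0`; and the formula `b_j(x) = φ_j((1,(h₀ j)_f)·(x,1))` — ★ F1 `resGen_eq_zero_of_presentation`'s binders `(cf φ hpres hstd hcont)`, `(aφ b hb hbfin hbc hφ)`,
`(y₀ := fun j => (h₀ j)_∞, hy₀)` (★ F2c ∘ `hdatum`). [cite: KudlaRallis1994, §1 Thm. 1.1] [cite: HarrisKudlaSweet1996, §1 (1.15)–(1.17)] [cite: BorelJacquet1979, §4.1] [cite: Tan1999, §1 p. 166] -/
theorem exists_archPure_presentation_archData (hM₂ : M₂ ≠ 0) {χb χ : HeckeCharacter L}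
    {sB : HA L e' dV hdV (tensorFrame L dW eW dV') (tensorFrame_real L dW hdW eW dV' hdV') →*
      MpD L e' dV hdV (tensorFrame L dW eW dV') (tensorFrame_real L dW hdW eW dV' hdV')}
    (hsB : IsDoubledWeilRep L e' dV hdV hdV0 (tensorFrame L dW eW dV') (tensorFrame_real L dW hdW eW dV' hdV')
      (tensorFrame_ne_zero L dW eW dV' hdW0 hdV'0) χb sB)
    {𝒦 : IwasawaDatum L e dV hdV dW hdW} (h𝒦 : 𝒦.IsStd)
    (V : Submodule ℂ 𝓢(((Fin (n' + n')) → mixedSpace (Fp L)), ℂ)) [FiniteDimensional ℂ V]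
    (hKV : ∀ ainf : UnitaryGroup.arch (Fp L) L (IsCMField.complexConj L) (n + n) (hermD L e dV hdV dW hdW),
      (UnitaryGroup.archToAdelic (Fp L) L (IsCMField.complexConj L) (n + n) (hermD L e dV hdV dW hdW) ainf : HA L e dV hdV dW hdW) ∈ 𝒦.K →
      ∀ a ∈ V, ∃ a'' ∈ V, ∀ f : FinSB (Fp L) (Fin (n' + n')),
        adelicMpCont.omega (Fp L) (Fin (n' + n')) (gramDA L e' dV hdV (tensorFrame L dW eW dV') (tensorFrame_real L dW hdW eW dV' hdV'))
            (sB (tensorEmb L e dV hdV dW hdW eW e' dV' hdV'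
              (UnitaryGroup.archToAdelic (Fp L) L (IsCMField.complexConj L) (n + n) (hermD L e dV hdV dW hdW) ainf)))
            (piSchwartzBruhatEquiv (Fp L) (Fin (n' + n')) (a ⊗ₜ[ℂ] f)) =
          piSchwartzBruhatEquiv (Fp L) (Fin (n' + n')) (a'' ⊗ₜ[ℂ] f))
    (α : UnitaryGroup.adelicOne (Fp L) L (IsCMField.complexConj L) →* ℂˣ) (hα : Continuous α)
    (hαrat : ∀ u : UnitaryGroup.adelicOne (Fp L) L (IsCMField.complexConj L), (u : ideleGroup L) ∈ principalIdeles L → α u = 1)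
    (hχ : χb ^ M₂ * DoubledWeilDetTwist.ratioHecke L α hα hαrat = χ)
    (x : ↥(Submodule.span ℂ {x : piSchwartzBruhat (Fp L) (Fin (n' + n')) |
        ∃ a ∈ V, ∃ f : FinSB (Fp L) (Fin (n' + n')), x = piSchwartzBruhatEquiv (Fp L) (Fin (n' + n')) (a ⊗ₜ[ℂ] f)}))
    -- ══ F2b `exists_archDatum_of_pureTensor` BY VALUE: the archimedean kernel datum of every pure-tensor generator with a base point ══
    (hdatum : ∀ a ∈ V, ∀ (f : FinSB (Fp L) (Fin (n' + n'))) (h₀ : HA L e dV hdV dW hdW),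
      ((DoubledWeilDetTwist.detChar L e dV hdV hdV0 dW hdW hdW0 α h₀ : ℂˣ) : ℂ) *
          swSectionTensor L e dV hdV dW hdW eW e' dV' hdV' hdV0 hdW0 hdV'0 sB (piSchwartzBruhatEquiv (Fp L) (Fin (n' + n')) (a ⊗ₜ[ℂ] f)) h₀ ≠ 0 →
      ∃ (aφ : UnitaryGroup.finAdelic (Fp L) L (IsCMField.complexConj L) (n + n) (hermD L e dV hdV dW hdW) → ℂ)
        (b : UnitaryGroup.arch (Fp L) L (IsCMField.complexConj L) (n + n) (hermD L e dV hdV dW hdW) → ℂ),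
        (∀ h : HA L e dV hdV dW hdW,
          ((DoubledWeilDetTwist.detChar L e dV hdV hdV0 dW hdW hdW0 α h : ℂˣ) : ℂ) *
              swSectionTensor L e dV hdV dW hdW eW e' dV' hdV' hdV0 hdW0 hdV'0 sB (piSchwartzBruhatEquiv (Fp L) (Fin (n' + n')) (a ⊗ₜ[ℂ] f)) h =
            aφ (UnitaryGroup.finPart (Fp L) L (IsCMField.complexConj L) (n + n) (hermD L e dV hdV dW hdW) h) *
              b (UnitaryGroup.archPart (Fp L) L (IsCMField.complexConj L) (n + n) (hermD L e dV hdV dW hdW) h)) ∧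
        (∀ p : HA L e dV hdV dW hdW, GRConstruction.IsSiegelDelta L e dV hdV dW hdW p →
          UnitaryGroup.finPart (Fp L) L (IsCMField.complexConj L) (n + n) (hermD L e dV hdV dW hdW) p = 1 →
          ∀ xa : UnitaryGroup.arch (Fp L) L (IsCMField.complexConj L) (n + n) (hermD L e dV hdV dW hdW),
            b (UnitaryGroup.archPart (Fp L) L (IsCMField.complexConj L) (n + n) (hermD L e dV hdV dW hdW) p * xa) =
              siegelDeltaCharacter L e dV hdV dW hdW χ (((M₂ : ℂ) - (n : ℂ)) / 2) p * b xa) ∧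
        (∃ Vb : Submodule ℂ (UnitaryGroup.arch (Fp L) L (IsCMField.complexConj L) (n + n) (hermD L e dV hdV dW hdW) → ℂ), FiniteDimensional ℂ Vb ∧ b ∈ Vb ∧
          ∀ a₀ : UnitaryGroup.arch (Fp L) L (IsCMField.complexConj L) (n + n) (hermD L e dV hdV dW hdW),
            (UnitaryGroup.archToAdelic (Fp L) L (IsCMField.complexConj L) (n + n) (hermD L e dV hdV dW hdW) a₀ : HA L e dV hdV dW hdW) ∈ 𝒦.K →
            ∀ G ∈ Vb, (fun xa => G (xa * a₀)) ∈ Vb) ∧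
        Continuous b ∧
        b (UnitaryGroup.archPart (Fp L) L (IsCMField.complexConj L) (n + n) (hermD L e dV hdV dW hdW) h₀) ≠ 0 ∧
        (∀ xa : UnitaryGroup.arch (Fp L) L (IsCMField.complexConj L) (n + n) (hermD L e dV hdV dW hdW),
          b xa = ((DoubledWeilDetTwist.detChar L e dV hdV hdV0 dW hdW hdW0 α
                (UnitaryGroup.finAdelicToAdelic (Fp L) L (IsCMField.complexConj L) (n + n) (hermD L e dV hdV dW hdW)
                    (UnitaryGroup.finPart (Fp L) L (IsCMField.complexConj L) (n + n) (hermD L e dV hdV dW hdW) h₀) *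
                  UnitaryGroup.archToAdelic (Fp L) L (IsCMField.complexConj L) (n + n) (hermD L e dV hdV dW hdW) xa) : ℂˣ) : ℂ) *
            swSectionTensor L e dV hdV dW hdW eW e' dV' hdV' hdV0 hdW0 hdV'0 sB (piSchwartzBruhatEquiv (Fp L) (Fin (n' + n')) (a ⊗ₜ[ℂ] f))
              (UnitaryGroup.finAdelicToAdelic (Fp L) L (IsCMField.complexConj L) (n + n) (hermD L e dV hdV dW hdW)
                  (UnitaryGroup.finPart (Fp L) L (IsCMField.complexConj L) (n + n) (hermD L e dV hdV dW hdW) h₀) *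
                UnitaryGroup.archToAdelic (Fp L) L (IsCMField.complexConj L) (n + n) (hermD L e dV hdV dW hdW) xa))) :
    ∃ (m : ℕ) (cf : Fin m → ℂ) (av : Fin m → 𝓢(((Fin (n' + n')) → mixedSpace (Fp L)), ℂ)) (fv : Fin m → FinSB (Fp L) (Fin (n' + n')))
      (h₀ : Fin m → HA L e dV hdV dW hdW)
      (aφ : Fin m → UnitaryGroup.finAdelic (Fp L) L (IsCMField.complexConj L) (n + n) (hermD L e dV hdV dW hdW) → ℂ)
      (b : Fin m → UnitaryGroup.arch (Fp L) L (IsCMField.complexConj L) (n + n) (hermD L e dV hdV dW hdW) → ℂ),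
      -- the generators lie in `V`
      (∀ j, av j ∈ V) ∧
      -- (hpres) the presentation of the twisted Siegel–Weil family of `x`
      ((fun s₁ h₁ => ((DoubledWeilDetTwist.detChar L e dV hdV hdV0 dW hdW hdW0 α h₁ : ℂˣ) : ℂ) *
          stdExtension 𝒦 (((M₂ : ℂ) - (n : ℂ)) / 2)
            (swSectionTensor L e dV hdV dW hdW eW e' dV' hdV' hdV0 hdW0 hdV'0 sB (x : piSchwartzBruhat (Fp L) (Fin (n' + n')))) s₁ h₁) =
        ∑ j, cf j • stdExtension 𝒦 (((M₂ : ℂ) - (n : ℂ)) / 2)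
          (fun h => ((DoubledWeilDetTwist.detChar L e dV hdV hdV0 dW hdW hdW0 α h : ℂˣ) : ℂ) *
            swSectionTensor L e dV hdV dW hdW eW e' dV' hdV' hdV0 hdW0 hdV'0 sB (piSchwartzBruhatEquiv (Fp L) (Fin (n' + n')) (av j ⊗ₜ[ℂ] fv j)) h)) ∧
      -- (hstd) every summand is a standard family for `(𝒦, χ)`
      (∀ j, IsStandardSectionFamily 𝒦 χ (stdExtension 𝒦 (((M₂ : ℂ) - (n : ℂ)) / 2)
        (fun h => ((DoubledWeilDetTwist.detChar L e dV hdV hdV0 dW hdW hdW0 α h : ℂˣ) : ℂ) *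
          swSectionTensor L e dV hdV dW hdW eW e' dV' hdV' hdV0 hdW0 hdV'0 sB (piSchwartzBruhatEquiv (Fp L) (Fin (n' + n')) (av j ⊗ₜ[ℂ] fv j)) h))) ∧
      -- (hcont) every summand is continuous in `h`
      (∀ j (s : ℂ), Continuous (stdExtension 𝒦 (((M₂ : ℂ) - (n : ℂ)) / 2)
        (fun h => ((DoubledWeilDetTwist.detChar L e dV hdV hdV0 dW hdW hdW0 α h : ℂˣ) : ℂ) *
          swSectionTensor L e dV hdV dW hdW eW e' dV' hdV' hdV0 hdW0 hdV'0 sB (piSchwartzBruhatEquiv (Fp L) (Fin (n' + n')) (av j ⊗ₜ[ℂ] fv j)) h) s)) ∧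
      -- (hφ) purity of every summand's origin section
      (∀ j (h : HA L e dV hdV dW hdW),
        ((DoubledWeilDetTwist.detChar L e dV hdV hdV0 dW hdW hdW0 α h : ℂˣ) : ℂ) *
            swSectionTensor L e dV hdV dW hdW eW e' dV' hdV' hdV0 hdW0 hdV'0 sB (piSchwartzBruhatEquiv (Fp L) (Fin (n' + n')) (av j ⊗ₜ[ℂ] fv j)) h =
          aφ j (UnitaryGroup.finPart (Fp L) L (IsCMField.complexConj L) (n + n) (hermD L e dV hdV dW hdW) h) *
            b j (UnitaryGroup.archPart (Fp L) L (IsCMField.complexConj L) (n + n) (hermD L e dV hdV dW hdW) h)) ∧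
      -- (hb) the archimedean Siegel law at `s₀ = (M₂ − n)/2`
      (∀ j (p : HA L e dV hdV dW hdW), GRConstruction.IsSiegelDelta L e dV hdV dW hdW p →
        UnitaryGroup.finPart (Fp L) L (IsCMField.complexConj L) (n + n) (hermD L e dV hdV dW hdW) p = 1 →
        ∀ xa : UnitaryGroup.arch (Fp L) L (IsCMField.complexConj L) (n + n) (hermD L e dV hdV dW hdW),
          b j (UnitaryGroup.archPart (Fp L) L (IsCMField.complexConj L) (n + n) (hermD L e dV hdV dW hdW) p * xa) =
            siegelDeltaCharacter L e dV hdV dW hdW χ (((M₂ : ℂ) - (n : ℂ)) / 2) p * b j xa) ∧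
      -- (hbfin) `K_∞`-finiteness w.r.t. `𝒦.K`
      (∀ j, ∃ Vb : Submodule ℂ (UnitaryGroup.arch (Fp L) L (IsCMField.complexConj L) (n + n) (hermD L e dV hdV dW hdW) → ℂ), FiniteDimensional ℂ Vb ∧ b j ∈ Vb ∧
        ∀ a₀ : UnitaryGroup.arch (Fp L) L (IsCMField.complexConj L) (n + n) (hermD L e dV hdV dW hdW),
          (UnitaryGroup.archToAdelic (Fp L) L (IsCMField.complexConj L) (n + n) (hermD L e dV hdV dW hdW) a₀ : HA L e dV hdV dW hdW) ∈ 𝒦.K →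
          ∀ G ∈ Vb, (fun xa => G (xa * a₀)) ∈ Vb) ∧
      -- (hbc) continuity
      (∀ j, Continuous (b j)) ∧
      -- (hy₀) the base points `y₀ j := (h₀ j)_∞`
      (∀ j, b j (UnitaryGroup.archPart (Fp L) L (IsCMField.complexConj L) (n + n) (hermD L e dV hdV dW hdW) (h₀ j)) ≠ 0) ∧
      -- the formula for `b j`
      (∀ j (xa : UnitaryGroup.arch (Fp L) L (IsCMField.complexConj L) (n + n) (hermD L e dV hdV dW hdW)),
        b j xa = ((DoubledWeilDetTwist.detChar L e dV hdV hdV0 dW hdW hdW0 α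
              (UnitaryGroup.finAdelicToAdelic (Fp L) L (IsCMField.complexConj L) (n + n) (hermD L e dV hdV dW hdW)
                  (UnitaryGroup.finPart (Fp L) L (IsCMField.complexConj L) (n + n) (hermD L e dV hdV dW hdW) (h₀ j)) *
                UnitaryGroup.archToAdelic (Fp L) L (IsCMField.complexConj L) (n + n) (hermD L e dV hdV dW hdW) xa) : ℂˣ) : ℂ) *
          swSectionTensor L e dV hdV dW hdW eW e' dV' hdV' hdV0 hdW0 hdV'0 sB (piSchwartzBruhatEquiv (Fp L) (Fin (n' + n')) (av j ⊗ₜ[ℂ] fv j))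
            (UnitaryGroup.finAdelicToAdelic (Fp L) L (IsCMField.complexConj L) (n + n) (hermD L e dV hdV dW hdW)
                (UnitaryGroup.finPart (Fp L) L (IsCMField.complexConj L) (n + n) (hermD L e dV hdV dW hdW) (h₀ j)) *
              UnitaryGroup.archToAdelic (Fp L) L (IsCMField.complexConj L) (n + n) (hermD L e dV hdV dW hdW) xa)) := by
  -- ★ F2c: the presentation with base points
  obtain ⟨m, cf, a, f, h₀, haV, hpres, hstd, hcont, hφ₀⟩ :=
    exists_archPure_presentation L e dV hdV hdV0 dW hdW hdW0 eW e' dV' hdV' hdV'0 hM₂ hsB h𝒦 V hKV α hα hαrat hχ x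
  -- F2b (by value) at every kept summand
  choose aφ b hdat using fun j => hdatum (a j) (haV j) (f j) (h₀ j) (hφ₀ j)
  exact ⟨m, cf, a, f, h₀, aφ, b, haV, hpres, hstd, hcont, fun j => (hdat j).1, fun j => (hdat j).2.1, fun j => (hdat j).2.2.1,
    fun j => (hdat j).2.2.2.1, fun j => (hdat j).2.2.2.2.1, fun j => (hdat j).2.2.2.2.2⟩


/-! ## §2 The by-name edition: `hdatum` discharged by ★ F2b p865003 `exists_archDatum_of_pureTensor` -/

/-- **THE ARCH DATA OF RECORD, BY NAME.**  §1 with F2b's per-summand datum DISCHARGED by ★ `K2LiuTwistedSWPureTensorArchDatum.exists_archDatum_of_pureTensor` (LH4-p09 (g11),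
p865003): no by-value letter left — for `x ∈ D_V` the whole `j`-indexed presentation surface of ★ F1 `resGen_eq_zero_of_presentation` (`cf φ hpres hstd hcont`, `aφ b hb hbfin hbc hφ`,
`y₀ hy₀`, and the formula for `b j`) in ONE `∃`.  Extra binders w.r.t. §1: F2b's `(hχbu : χb.IsUnitary) (hχbs : IsSplittingChar L 1 χb)`.
[cite: KudlaRallis1994, §1 Thm. 1.1] [cite: HarrisKudlaSweet1996, §1 (1.15)–(1.17)] [cite: BorelJacquet1979, §4.1] [cite: Tan1999, §1 p. 166] -/
theorem exists_archPure_presentation_archData_of_record (hM₂ : M₂ ≠ 0) {χb χ : HeckeCharacter L} (hχbu : χb.IsUnitary) (hχbs : IsSplittingChar L 1 χb)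
    {sB : HA L e' dV hdV (tensorFrame L dW eW dV') (tensorFrame_real L dW hdW eW dV' hdV') →*
      MpD L e' dV hdV (tensorFrame L dW eW dV') (tensorFrame_real L dW hdW eW dV' hdV')}
    (hsB : IsDoubledWeilRep L e' dV hdV hdV0 (tensorFrame L dW eW dV') (tensorFrame_real L dW hdW eW dV' hdV')
      (tensorFrame_ne_zero L dW eW dV' hdW0 hdV'0) χb sB)
    {𝒦 : IwasawaDatum L e dV hdV dW hdW} (h𝒦 : 𝒦.IsStd)
    (V : Submodule ℂ 𝓢(((Fin (n' + n')) → mixedSpace (Fp L)), ℂ)) [FiniteDimensional ℂ V]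
    (hKV : ∀ ainf : UnitaryGroup.arch (Fp L) L (IsCMField.complexConj L) (n + n) (hermD L e dV hdV dW hdW),
      (UnitaryGroup.archToAdelic (Fp L) L (IsCMField.complexConj L) (n + n) (hermD L e dV hdV dW hdW) ainf : HA L e dV hdV dW hdW) ∈ 𝒦.K →
      ∀ a ∈ V, ∃ a'' ∈ V, ∀ f : FinSB (Fp L) (Fin (n' + n')),
        adelicMpCont.omega (Fp L) (Fin (n' + n')) (gramDA L e' dV hdV (tensorFrame L dW eW dV') (tensorFrame_real L dW hdW eW dV' hdV'))
            (sB (tensorEmb L e dV hdV dW hdW eW e' dV' hdV'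
              (UnitaryGroup.archToAdelic (Fp L) L (IsCMField.complexConj L) (n + n) (hermD L e dV hdV dW hdW) ainf)))
            (piSchwartzBruhatEquiv (Fp L) (Fin (n' + n')) (a ⊗ₜ[ℂ] f)) =
          piSchwartzBruhatEquiv (Fp L) (Fin (n' + n')) (a'' ⊗ₜ[ℂ] f))
    (α : UnitaryGroup.adelicOne (Fp L) L (IsCMField.complexConj L) →* ℂˣ) (hα : Continuous α)
    (hαrat : ∀ u : UnitaryGroup.adelicOne (Fp L) L (IsCMField.complexConj L), (u : ideleGroup L) ∈ principalIdeles L → α u = 1)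
    (hχ : χb ^ M₂ * DoubledWeilDetTwist.ratioHecke L α hα hαrat = χ)
    (x : ↥(Submodule.span ℂ {x : piSchwartzBruhat (Fp L) (Fin (n' + n')) |
        ∃ a ∈ V, ∃ f : FinSB (Fp L) (Fin (n' + n')), x = piSchwartzBruhatEquiv (Fp L) (Fin (n' + n')) (a ⊗ₜ[ℂ] f)})) :
    ∃ (m : ℕ) (cf : Fin m → ℂ) (av : Fin m → 𝓢(((Fin (n' + n')) → mixedSpace (Fp L)), ℂ)) (fv : Fin m → FinSB (Fp L) (Fin (n' + n')))
      (h₀ : Fin m → HA L e dV hdV dW hdW)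
      (aφ : Fin m → UnitaryGroup.finAdelic (Fp L) L (IsCMField.complexConj L) (n + n) (hermD L e dV hdV dW hdW) → ℂ)
      (b : Fin m → UnitaryGroup.arch (Fp L) L (IsCMField.complexConj L) (n + n) (hermD L e dV hdV dW hdW) → ℂ),
      -- the generators lie in `V`
      (∀ j, av j ∈ V) ∧
      -- (hpres) the presentation of the twisted Siegel–Weil family of `x`
      ((fun s₁ h₁ => ((DoubledWeilDetTwist.detChar L e dV hdV hdV0 dW hdW hdW0 α h₁ : ℂˣ) : ℂ) *
          stdExtension 𝒦 (((M₂ : ℂ) - (n : ℂ)) / 2)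
            (swSectionTensor L e dV hdV dW hdW eW e' dV' hdV' hdV0 hdW0 hdV'0 sB (x : piSchwartzBruhat (Fp L) (Fin (n' + n')))) s₁ h₁) =
        ∑ j, cf j • stdExtension 𝒦 (((M₂ : ℂ) - (n : ℂ)) / 2)
          (fun h => ((DoubledWeilDetTwist.detChar L e dV hdV hdV0 dW hdW hdW0 α h : ℂˣ) : ℂ) *
            swSectionTensor L e dV hdV dW hdW eW e' dV' hdV' hdV0 hdW0 hdV'0 sB (piSchwartzBruhatEquiv (Fp L) (Fin (n' + n')) (av j ⊗ₜ[ℂ] fv j)) h)) ∧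
      -- (hstd) every summand is a standard family for `(𝒦, χ)`
      (∀ j, IsStandardSectionFamily 𝒦 χ (stdExtension 𝒦 (((M₂ : ℂ) - (n : ℂ)) / 2)
        (fun h => ((DoubledWeilDetTwist.detChar L e dV hdV hdV0 dW hdW hdW0 α h : ℂˣ) : ℂ) *
          swSectionTensor L e dV hdV dW hdW eW e' dV' hdV' hdV0 hdW0 hdV'0 sB (piSchwartzBruhatEquiv (Fp L) (Fin (n' + n')) (av j ⊗ₜ[ℂ] fv j)) h))) ∧
      -- (hcont) every summand is continuous in `h`
      (∀ j (s : ℂ), Continuous (stdExtension 𝒦 (((M₂ : ℂ) - (n : ℂ)) / 2)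
        (fun h => ((DoubledWeilDetTwist.detChar L e dV hdV hdV0 dW hdW hdW0 α h : ℂˣ) : ℂ) *
          swSectionTensor L e dV hdV dW hdW eW e' dV' hdV' hdV0 hdW0 hdV'0 sB (piSchwartzBruhatEquiv (Fp L) (Fin (n' + n')) (av j ⊗ₜ[ℂ] fv j)) h) s)) ∧
      -- (hφ) purity of every summand's origin section
      (∀ j (h : HA L e dV hdV dW hdW),
        ((DoubledWeilDetTwist.detChar L e dV hdV hdV0 dW hdW hdW0 α h : ℂˣ) : ℂ) *
            swSectionTensor L e dV hdV dW hdW eW e' dV' hdV' hdV0 hdW0 hdV'0 sB (piSchwartzBruhatEquiv (Fp L) (Fin (n' + n')) (av j ⊗ₜ[ℂ] fv j)) h =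
          aφ j (UnitaryGroup.finPart (Fp L) L (IsCMField.complexConj L) (n + n) (hermD L e dV hdV dW hdW) h) *
            b j (UnitaryGroup.archPart (Fp L) L (IsCMField.complexConj L) (n + n) (hermD L e dV hdV dW hdW) h)) ∧
      -- (hb) the archimedean Siegel law at `s₀ = (M₂ − n)/2`
      (∀ j (p : HA L e dV hdV dW hdW), GRConstruction.IsSiegelDelta L e dV hdV dW hdW p →
        UnitaryGroup.finPart (Fp L) L (IsCMField.complexConj L) (n + n) (hermD L e dV hdV dW hdW) p = 1 →
        ∀ xa : UnitaryGroup.arch (Fp L) L (IsCMField.complexConj L) (n + n) (hermD L e dV hdV dW hdW),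
          b j (UnitaryGroup.archPart (Fp L) L (IsCMField.complexConj L) (n + n) (hermD L e dV hdV dW hdW) p * xa) =
            siegelDeltaCharacter L e dV hdV dW hdW χ (((M₂ : ℂ) - (n : ℂ)) / 2) p * b j xa) ∧
      -- (hbfin) `K_∞`-finiteness w.r.t. `𝒦.K`
      (∀ j, ∃ Vb : Submodule ℂ (UnitaryGroup.arch (Fp L) L (IsCMField.complexConj L) (n + n) (hermD L e dV hdV dW hdW) → ℂ), FiniteDimensional ℂ Vb ∧ b j ∈ Vb ∧
        ∀ a₀ : UnitaryGroup.arch (Fp L) L (IsCMField.complexConj L) (n + n) (hermD L e dV hdV dW hdW),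
          (UnitaryGroup.archToAdelic (Fp L) L (IsCMField.complexConj L) (n + n) (hermD L e dV hdV dW hdW) a₀ : HA L e dV hdV dW hdW) ∈ 𝒦.K →
          ∀ G ∈ Vb, (fun xa => G (xa * a₀)) ∈ Vb) ∧
      -- (hbc) continuity
      (∀ j, Continuous (b j)) ∧
      -- (hy₀) the base points `y₀ j := (h₀ j)_∞`
      (∀ j, b j (UnitaryGroup.archPart (Fp L) L (IsCMField.complexConj L) (n + n) (hermD L e dV hdV dW hdW) (h₀ j)) ≠ 0) ∧
      -- the formula for `b j`
      (∀ j (xa : UnitaryGroup.arch (Fp L) L (IsCMField.complexConj L) (n + n) (hermD L e dV hdV dW hdW)),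
        b j xa = ((DoubledWeilDetTwist.detChar L e dV hdV hdV0 dW hdW hdW0 α
              (UnitaryGroup.finAdelicToAdelic (Fp L) L (IsCMField.complexConj L) (n + n) (hermD L e dV hdV dW hdW)
                  (UnitaryGroup.finPart (Fp L) L (IsCMField.complexConj L) (n + n) (hermD L e dV hdV dW hdW) (h₀ j)) *
                UnitaryGroup.archToAdelic (Fp L) L (IsCMField.complexConj L) (n + n) (hermD L e dV hdV dW hdW) xa) : ℂˣ) : ℂ) *
          swSectionTensor L e dV hdV dW hdW eW e' dV' hdV' hdV0 hdW0 hdV'0 sB (piSchwartzBruhatEquiv (Fp L) (Fin (n' + n')) (av j ⊗ₜ[ℂ] fv j))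
            (UnitaryGroup.finAdelicToAdelic (Fp L) L (IsCMField.complexConj L) (n + n) (hermD L e dV hdV dW hdW)
                (UnitaryGroup.finPart (Fp L) L (IsCMField.complexConj L) (n + n) (hermD L e dV hdV dW hdW) (h₀ j)) *
              UnitaryGroup.archToAdelic (Fp L) L (IsCMField.complexConj L) (n + n) (hermD L e dV hdV dW hdW) xa)) :=
  exists_archPure_presentation_archData L e dV hdV hdV0 dW hdW hdW0 eW e' dV' hdV' hdV'0 hM₂ hsB h𝒦 V hKV α hα hαrat hχ x
    fun _ ha f h₀ hφ₀ => exists_archDatum_of_pureTensor L e dV hdV dW hdW hdV0 hdW0 eW e' dV' hdV' hdV'0 hM₂ hχbu hχbs hsB h𝒦 V hKV α hα hαrat hχ ha f h₀ hφ₀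

end Summit.HodgeConjecture.HodgeConjecture.Cruxes.HLiu418.K2LiuTwistedSWFamilyArchDataOfRecord

end
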